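/-
rh-inputs cell (A1 = `Grosswald1967_thmB`), prover-3, 2026-08-28.  The Laguerre–Fejér rule of signs
for truncated Mellin moments — the `stub_laguerre` piece of `a1/Grosswald1967Skeleton.lean`.
Self-contained real analysis; nothing in this file bears on the truth of RH.
-/
import Mathlib.MeasureTheory.Function.LocallyIntegrable
import Mathlib.MeasureTheory.Integral.Bochner.Set
import Mathlib.Analysis.SpecialFunctions.Pow.Real
import Mathlib.Algebra.BigOperators.Intervals
import Mathlib.Algebra.Order.BigOperators.Group.Finset
import Mathlib.Data.Fin.VecNotation
import Literature.NumberTheory.LFunctions.PolyaSignChangesMomentDefs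
import Literature.NumberTheory.LFunctions.PolyaSignChangesLaguerreChains
import HarnessLib

/-!
# Sign changes of truncated Mellin moments (Laguerre–Fejér rule of signs)

**Theorem** (`laguerre_truncatedMoments`).  Let `g : ℝ → ℝ`, `λ ∈ ℝ`, `y ∈ ℝ`, with
`g(t) t^{-(λ+1)}` integrable on `(1, y]`, and suppose every alternating chain
`1 < x₀ < ⋯ < xₙ ≤ y`, `g(xᵢ) g(xᵢ₊₁) < 0`, has length `n ≤ N` (at most `N` reversals of sign of
`g` on `(1, y]`).  Then the finite moment sequence `a_k = ∫_{(1,y]} g(t) (log t)^k t^{-(λ+1)} dt`,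
`k = 0, …, K`, has at most `N` changes of sign (`SeqSignChangesLE a K N`, from
`PolyaSignChangesMomentDefs`: every index chain `κ₀ < ⋯ < κₙ ≤ K` with `a(κᵢ) a(κᵢ₊₁) < 0` has
`n ≤ N`).

This is the finite-interval, `log`-variable form of Pólya–Szegő II, Part V, Chap. 1, Problem 81
(after Fejér 1914: "the number of reversals of sign of `f` is not less than the number of changes
of sign of its moment sequence"), i.e. the variation-diminishing property of the kernel `s^k`; it is
the `stub_laguerre` input of the A1 architecture for `Grosswald1967_thmB` (Descartes–Laguerre
moment method), consumed by `PolyaSignChangesCounting` (PieceA) through `pieceA_of_laguerre`.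

## Proof (sequence analogue of Laguerre's argument, PSz V.80; no complex analysis, no Rolle)

Induction on `N`, simultaneously for all weights `w` integrable on `S = (1, y]` (here
`w = g · t^{-(λ+1)}`, moments `a_k = ∫_S w (log t)^k`):
* `N = 0`: `w` is weakly one-signed on `S`, hence so is every `a_k` — no strict change of sign.
* `N → N + 1`: if `w` has no chain of length `N + 1` the bound `N` already applies.  Otherwise the
  breakpoint lemma `Laguerre.chainBound_mul_log_sub` (file `PolyaSignChangesLaguerreChains`)
  supplies `c > 0` such that `w'(t) := w(t) (log t − c)` has chain bound `N`; its moments are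
  `b_k = a_{k+1} − c a_k`, so by induction `b` has `≤ N` changes of sign, and the discrete lemma
  `Laguerre.seqSignChangesLE_of_shift` (PSz V.19 without the leading term: for `c > 0`,
  `V(a₀..a_K) ≤ V(b₀..b_{K-1}) + 1`, via `u_k = a_k / c^k`, `b_k = c^{k+1} (u_{k+1} − u_k)` and a
  telescoping sum between consecutive changes of `u`) gives `≤ N + 1` changes for `a`.

## Contents / interface

Public: `Laguerre.seqSignChangesLE_of_shift` (discrete lemma, PSz V.19),
`Laguerre.seqSignChangesLE_moments` (the rule of signs for a general weight `w` on `(1, y]`,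
PSz V.81) and `laguerre_truncatedMoments` — the statement with the binders of the A1 skeleton's
`stub_laguerre` (name changed only; the binder `1 ≤ y` of the skeleton is idle and kept as `_hy` so
that the consumer `pieceA_of_laguerre` applies verbatim).  Private plumbing: sign lemmas,
`seqSignChangesLE_mono`, integrability of `w (log t)^k` / `w (log t − c)` on `(1, y]`,
`moment_mul_log_sub` (moments of the shifted weight), `seqSignChangesLE_moments_zero` (base case).

## References

* G. Pólya, G. Szegő, *Problems and Theorems in Analysis II*, Part V, Chap. 1, Problems 19, 80, 81
  (Springer 1976). [PolyaSzego1976]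
* L. Fejér, C. R. Acad. Sci. Paris 158 (1914) 1328–1331 (cited through PSz V.81).
-/

noncomputable section

open Set MeasureTheory

namespace Literature.NumberTheory.LFunctions

namespace PolyaSignChanges

namespace Laguerre

/-! ### Sign bookkeeping (private copies of the plumbing in `PolyaSignChangesLaguerreChains`) -/

/-- `ab < 0`, `b > 0` ⇒ `a < 0`. [folklore] -/
private theorem neg_of_mul_neg_of_pos {a b : ℝ} (h : a * b < 0) (hb : 0 < b) : a < 0 :=
  (mul_neg_iff.1 h).elim (fun h' => absurd hb (not_lt.2 h'.2.le)) fun h' => h'.1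

/-- Relative signs compose: `ab > 0`, `bc < 0` ⇒ `ac < 0`. [folklore] -/
private theorem sgn_pos_neg {a b c : ℝ} (h1 : 0 < a * b) (h2 : b * c < 0) : a * c < 0 := by
  have hb : b ≠ 0 := (mul_ne_zero_iff.1 h1.ne').2
  have h : (a * c) * (b * b) < 0 := by
    have := mul_neg_of_pos_of_neg h1 h2
    calc a * c * (b * b) = a * b * (b * c) := by ring
      _ < 0 := this
  exact neg_of_mul_neg_of_pos h (mul_self_pos.2 hb)

/-- Relative signs compose: `ab < 0`, `bc > 0` ⇒ `ac < 0`. [folklore] -/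
private theorem sgn_neg_pos {a b c : ℝ} (h1 : a * b < 0) (h2 : 0 < b * c) : a * c < 0 := by
  have h1' : 0 < c * b := by rw [mul_comm]; exact h2
  have h2' : b * a < 0 := by rw [mul_comm]; exact h1
  rw [mul_comm]; exact sgn_pos_neg h1' h2'

/-! ### The discrete lemma (PSz V.19, without the leading term) -/

/-- **Discrete lemma.**  If `c > 0`, `b k = a (k+1) − c · a k` for all `k`, and `b 0, …, b K` has at
most `N` changes of sign, then `a 0, …, a K` has at most `N + 1`.  (With `u k = a k / c^k` one has
`b k = c^{k+1} (u (k+1) − u k)`; between two consecutive strict sign changes of `u` a telescoping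
sum locates an index where the increment has the sign of the later term.)
[cite: PolyaSzego1976, Part V, Chap. 1, Problem 19] -/
theorem seqSignChangesLE_of_shift {a b : ℕ → ℝ} {c : ℝ} (hc : 0 < c)
    (hab : ∀ k, b k = a (k + 1) - c * a k) {K N : ℕ} (hb : SeqSignChangesLE b K N) :
    SeqSignChangesLE a K (N + 1) := by
  intro n κ hκ hK hsign
  cases n with
  | zero => exact Nat.zero_le _
  | succ m =>
    have hcpow : ∀ k, 0 < c ^ k := fun k => pow_pos hc k
    -- `u k = a k / c ^ k`
    have hbu : ∀ k, b k = c ^ (k + 1) * (a (k + 1) / c ^ (k + 1) - a k / c ^ k) := by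
      intro k
      rw [hab k, mul_sub, mul_div_cancel₀ _ (hcpow (k + 1)).ne', pow_succ, mul_comm (c ^ k) c,
        mul_assoc, mul_div_cancel₀ _ (hcpow k).ne']
    have husign : ∀ i : Fin (m + 1), a (κ i.castSucc) / c ^ κ i.castSucc *
        (a (κ i.succ) / c ^ κ i.succ) < 0 := by
      intro i
      rw [div_mul_div_comm]
      exact div_neg_of_neg_of_pos (hsign i) (mul_pos (hcpow _) (hcpow _))
    -- between `κ i` and `κ (i+1)` an increment of `u` with the sign of `u (κ (i+1))`
    have hstep : ∀ i : Fin (m + 1), ∃ k, κ i.castSucc ≤ k ∧ k < κ i.succ ∧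
        0 < a (κ i.succ) / c ^ κ i.succ * (a (k + 1) / c ^ (k + 1) - a k / c ^ k) := by
      intro i
      have hlt : κ i.castSucc < κ i.succ := hκ i.castSucc_lt_succ
      have htele : ∑ k ∈ Finset.Ico (κ i.castSucc) (κ i.succ), (a (k + 1) / c ^ (k + 1) - a k / c ^ k)
          = a (κ i.succ) / c ^ κ i.succ - a (κ i.castSucc) / c ^ κ i.castSucc :=
        Finset.sum_Ico_sub (fun k => a k / c ^ k) hlt.le
      have hne : a (κ i.succ) / c ^ κ i.succ ≠ 0 := (mul_ne_zero_iff.1 (husign i).ne).2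
      have hpos : 0 < ∑ k ∈ Finset.Ico (κ i.castSucc) (κ i.succ),
          a (κ i.succ) / c ^ κ i.succ * (a (k + 1) / c ^ (k + 1) - a k / c ^ k) := by
        rw [← Finset.mul_sum, htele, mul_sub]
        have h1 := husign i
        have h2 : 0 < a (κ i.succ) / c ^ κ i.succ * (a (κ i.succ) / c ^ κ i.succ) :=
          mul_self_pos.2 hne
        rw [mul_comm] at h1
        linarith
      have hlt' : ∑ _k ∈ Finset.Ico (κ i.castSucc) (κ i.succ), (0 : ℝ) <
          ∑ k ∈ Finset.Ico (κ i.castSucc) (κ i.succ),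
            a (κ i.succ) / c ^ κ i.succ * (a (k + 1) / c ^ (k + 1) - a k / c ^ k) := by
        rw [Finset.sum_const_zero]; exact hpos
      obtain ⟨k, hk, hkpos⟩ := Finset.exists_lt_of_sum_lt hlt'
      exact ⟨k, (Finset.mem_Ico.1 hk).1, (Finset.mem_Ico.1 hk).2, hkpos⟩
    choose k hk1 hk2 hk3 using hstep
    have hm : m ≤ N := by
      refine hb m k ?_ ?_ ?_
      · intro i j hij
        have h1 := hk2 i
        have h2 : κ i.succ ≤ κ j.castSucc := hκ.monotone (by
          rw [Fin.le_def, Fin.val_succ, Fin.val_castSucc]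
          exact Fin.lt_def.1 hij)
        have h3 := hk1 j
        omega
      · intro i
        exact le_trans (hk2 i).le (hK _)
      · intro i
        rw [hbu, hbu]
        have hA := hk3 i.castSucc
        have hB := hk3 i.succ
        have hC := husign i.succ
        rw [Fin.succ_castSucc] at hA
        -- the two increments have the signs of `u (κ (i+1))`, `u (κ (i+2))`, which differ
        rw [mul_comm] at hA
        have hD := sgn_pos_neg hA hC
        have hE := sgn_neg_pos hD hB
        have hF := mul_pos (hcpow (k i.castSucc + 1)) (hcpow (k i.succ + 1))
        calc c ^ (k i.castSucc + 1) * (a (k i.castSucc + 1) / c ^ (k i.castSucc + 1) -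
              a (k i.castSucc) / c ^ k i.castSucc) *
            (c ^ (k i.succ + 1) * (a (k i.succ + 1) / c ^ (k i.succ + 1) - a (k i.succ) / c ^ k i.succ))
            = (c ^ (k i.castSucc + 1) * c ^ (k i.succ + 1)) *
              ((a (k i.castSucc + 1) / c ^ (k i.castSucc + 1) - a (k i.castSucc) / c ^ k i.castSucc) *
              (a (k i.succ + 1) / c ^ (k i.succ + 1) - a (k i.succ) / c ^ k i.succ)) := by ring
          _ < 0 := mul_neg_of_pos_of_neg hF hE
    omega

/-- Monotonicity of `SeqSignChangesLE` in the bound. [folklore] -/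
private theorem seqSignChangesLE_mono {a : ℕ → ℝ} {K N N' : ℕ} (h : SeqSignChangesLE a K N) (hN : N ≤ N') :
    SeqSignChangesLE a K N' :=
  fun n κ hκ hK hs => (h n κ hκ hK hs).trans hN

/-! ### Moments over `(1, y]` -/

/-- `w (log t)^k` is integrable on `(1, y]` when `w` is. [folklore] -/
private theorem integrableOn_mul_log_pow {w : ℝ → ℝ} {y : ℝ} (hw : IntegrableOn w (Ioc 1 y)) (k : ℕ) :
    IntegrableOn (fun t => w t * Real.log t ^ k) (Ioc 1 y) := by
  refine hw.mul_continuousOn_of_subset ?_ measurableSet_Ioc isCompact_Icc Ioc_subset_Icc_self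
  refine ContinuousOn.pow (Real.continuousOn_log.mono fun t ht => ?_) k
  exact Set.mem_compl_singleton_iff.2 (lt_of_lt_of_le one_pos ht.1).ne'

/-- `w (log t − c)` is integrable on `(1, y]` when `w` is. [folklore] -/
private theorem integrableOn_mul_log_sub {w : ℝ → ℝ} {y : ℝ} (hw : IntegrableOn w (Ioc 1 y)) (c : ℝ) :
    IntegrableOn (fun t => w t * (Real.log t - c)) (Ioc 1 y) := by
  refine hw.mul_continuousOn_of_subset ?_ measurableSet_Ioc isCompact_Icc Ioc_subset_Icc_self
  refine ContinuousOn.sub (Real.continuousOn_log.mono fun t ht => ?_) continuousOn_const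
  exact Set.mem_compl_singleton_iff.2 (lt_of_lt_of_le one_pos ht.1).ne'

/-- Moments of the shifted weight: `∫ w (log t − c) (log t)^k = a_{k+1} − c a_k`. [folklore] -/
private theorem moment_mul_log_sub {w : ℝ → ℝ} {y : ℝ} (hw : IntegrableOn w (Ioc 1 y)) (c : ℝ) (k : ℕ) :
    ∫ t in Ioc 1 y, (w t * (Real.log t - c)) * Real.log t ^ k =
      (∫ t in Ioc 1 y, w t * Real.log t ^ (k + 1)) - c * ∫ t in Ioc 1 y, w t * Real.log t ^ k := by
  have h1 := integrableOn_mul_log_pow hw (k + 1)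
  have h2 := integrableOn_mul_log_pow hw k
  have e : (fun t => (w t * (Real.log t - c)) * Real.log t ^ k) =
      fun t => w t * Real.log t ^ (k + 1) - c * (w t * Real.log t ^ k) := by
    funext t; ring
  rw [e, integral_sub h1 (h2.const_mul c), integral_const_mul]

/-- Base case: a weight without a sign change on `(1, y]` has weakly one-signed moments.
[folklore] -/
private theorem seqSignChangesLE_moments_zero {w : ℝ → ℝ} {y : ℝ}
    (h0 : ∀ (n : ℕ) (x : Fin (n + 1) → ℝ), StrictMono x → (∀ i, x i ∈ Ioc 1 y) →
      (∀ i : Fin n, w (x i.castSucc) * w (x i.succ) < 0) → n ≤ 0) (K : ℕ) :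
    SeqSignChangesLE (fun k => ∫ t in Ioc 1 y, w t * Real.log t ^ k) K 0 := by
  -- no two points carry opposite signs
  have key : ∀ s ∈ Ioc 1 y, ∀ t ∈ Ioc 1 y, s < t → 0 ≤ w s * w t := by
    intro s hs t ht hst
    by_contra hneg
    push Not at hneg
    have h2 := h0 1 ![s, t] (Fin.strictMono_iff_lt_succ.2 (Fin.forall_fin_one.2 (by simpa using hst)))
      (Fin.forall_fin_two.2 ⟨by simpa using hs, by simpa using ht⟩)
      (Fin.forall_fin_one.2 (by simpa using hneg))
    omega
  have hsign : (∀ t ∈ Ioc 1 y, 0 ≤ w t) ∨ (∀ t ∈ Ioc 1 y, w t ≤ 0) := by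
    by_cases hex : ∃ s ∈ Ioc 1 y, 0 < w s
    · left
      obtain ⟨s, hs, hws⟩ := hex
      intro t ht
      rcases lt_trichotomy s t with h | rfl | h
      · by_contra hlt; push Not at hlt
        exact absurd (key s hs t ht h) (not_le.2 (mul_neg_of_pos_of_neg hws hlt))
      · exact hws.le
      · by_contra hlt; push Not at hlt
        exact absurd (key t ht s hs h) (not_le.2 (mul_neg_of_neg_of_pos hlt hws))
    · right
      push Not at hex
      exact hex
  intro n κ hκ hK hs
  cases n with
  | zero => exact le_rfl
  | succ m =>
    exfalso
    have h := hs 0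
    rcases hsign with hpos | hneg
    · have hk : ∀ k : ℕ, 0 ≤ ∫ t in Ioc 1 y, w t * Real.log t ^ k := fun k =>
        setIntegral_nonneg measurableSet_Ioc fun t ht =>
          mul_nonneg (hpos t ht) (pow_nonneg (Real.log_nonneg ht.1.le) k)
      exact absurd h (not_lt.2 (mul_nonneg (hk _) (hk _)))
    · have hk : ∀ k : ℕ, (∫ t in Ioc 1 y, w t * Real.log t ^ k) ≤ 0 := fun k =>
        setIntegral_nonpos measurableSet_Ioc fun t ht =>
          mul_nonpos_of_nonpos_of_nonneg (hneg t ht) (pow_nonneg (Real.log_nonneg ht.1.le) k)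
      exact absurd h (not_lt.2 (mul_nonneg_of_nonpos_of_nonpos (hk _) (hk _)))

/-- **Laguerre–Fejér rule of signs for truncated Mellin moments, general weight.**  If `w` is
integrable on `(1, y]` and every alternating chain of `w` in `(1, y]` has length `≤ N`, then for every
`K` the moment sequence `k ↦ ∫_{(1,y]} w(t) (log t)^k dt`, `k ≤ K`, has at most `N` changes of sign.
[cite: PolyaSzego1976, Part V, Chap. 1, Problem 81] -/
theorem seqSignChangesLE_moments (y : ℝ) (N : ℕ) :
    ∀ (w : ℝ → ℝ), IntegrableOn w (Ioc 1 y) →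
      (∀ (n : ℕ) (x : Fin (n + 1) → ℝ), StrictMono x → (∀ i, x i ∈ Ioc 1 y) →
        (∀ i : Fin n, w (x i.castSucc) * w (x i.succ) < 0) → n ≤ N) →
      ∀ K : ℕ, SeqSignChangesLE (fun k => ∫ t in Ioc 1 y, w t * Real.log t ^ k) K N := by
  induction N with
  | zero =>
    intro w _ h0 K
    exact seqSignChangesLE_moments_zero h0 K
  | succ N ih =>
    intro w hw hN K
    by_cases hex : ∃ z : Fin (N + 2) → ℝ, StrictMono z ∧ (∀ i, z i ∈ Ioc 1 y) ∧
        ∀ i : Fin (N + 1), w (z i.castSucc) * w (z i.succ) < 0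
    · obtain ⟨z, hz, hzm, hzs⟩ := hex
      obtain ⟨c, hc, hbound⟩ := chainBound_mul_log_sub Ioc_subset_Ioi_self hN hz hzm hzs
      have hb := ih (fun t => w t * (Real.log t - c)) (integrableOn_mul_log_sub hw c) hbound K
      exact seqSignChangesLE_of_shift hc (fun k => moment_mul_log_sub hw c k) hb
    · exact seqSignChangesLE_mono (ih w hw (chainBound_of_not_exists hex) K) (Nat.le_succ N)

end Laguerre

/-- **Laguerre's rule of signs for truncated Mellin moments** (the `stub_laguerre` input of the A1
architecture for `Grosswald1967_thmB`, binders as in the skeleton).  If every alternating chain of `g`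
in `(1, y]` has length `≤ N` and `g(t) t^{-(λ+1)}` is integrable on `(1, y]`, then the truncated moment
sequence `k ↦ ∫_{(1,y]} g(t) (log t)^k t^{-(λ+1)} dt`, `k ≤ K`, has at most `N` changes of sign.
(The hypothesis `1 ≤ y` is idle — for `y < 1` the interval is empty — and is kept only to match the
registered signature.)  Proof: `Laguerre.seqSignChangesLE_moments` for the weight
`w = g · t^{-(λ+1)}`, which has the same sign pattern as `g` on `(1, y]`.
[cite: PolyaSzego1976, Part V, Chap. 1, Problem 81] -/
theorem laguerre_truncatedMoments (g : ℝ → ℝ) (lam y : ℝ) (K N : ℕ) (_hy : 1 ≤ y)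
    (hint : IntegrableOn (fun t : ℝ => g t * t ^ (-(lam + 1))) (Ioc 1 y))
    (hchain : ∀ (n : ℕ) (x : Fin (n + 1) → ℝ), StrictMono x → (∀ i, x i ∈ Ioc 1 y) →
      (∀ i : Fin n, g (x i.castSucc) * g (x i.succ) < 0) → n ≤ N) :
    SeqSignChangesLE (fun k => ∫ t in Ioc 1 y, g t * Real.log t ^ k * t ^ (-(lam + 1))) K N := by
  have hfun : (fun k : ℕ => ∫ t in Ioc 1 y, g t * Real.log t ^ k * t ^ (-(lam + 1))) =
      fun k : ℕ => ∫ t in Ioc 1 y, (g t * t ^ (-(lam + 1))) * Real.log t ^ k := by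
    funext k
    congr 1
    funext t
    ring
  rw [hfun]
  refine Laguerre.seqSignChangesLE_moments y N (fun t => g t * t ^ (-(lam + 1))) hint ?_ K
  intro n x hx hxm hxs
  refine hchain n x hx hxm fun i => ?_
  have h := hxs i
  have hp : 0 < x i.castSucc ^ (-(lam + 1)) * x i.succ ^ (-(lam + 1)) :=
    mul_pos (Real.rpow_pos_of_pos (lt_trans one_pos (hxm _).1) _)
      (Real.rpow_pos_of_pos (lt_trans one_pos (hxm _).1) _)
  have e : g (x i.castSucc) * x i.castSucc ^ (-(lam + 1)) * (g (x i.succ) * x i.succ ^ (-(lam + 1))) =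
      (g (x i.castSucc) * g (x i.succ)) * (x i.castSucc ^ (-(lam + 1)) * x i.succ ^ (-(lam + 1))) := by
    ring
  rw [e] at h
  exact Laguerre.neg_of_mul_neg_of_pos h hp

end PolyaSignChanges

end Literature.NumberTheory.LFunctions

end
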